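import Summits.QuantumFields.QCD.Theorems.SpectralDefectExtinctionWegnerEstimateCoareaRankMultiplicity

/-!
# Bridge lemma L toward stub `coareaWegner` of line `Sketch` (skeleton "ResolventCell", gen 2) for
crux `SpectralDefectExtinction.WegnerEstimate` (item stmt-QuantumFields-8966):
level-crossing count with multiplicity along a one-link circle, uniformly in the volume

The 1-D area inequality (bridge J, `coareaWegner_lintegral_deriv_mul_le_crossings`) bounds the
circle integral `∫ |Λ_i'| φ(Λ_i)` of each sorted eigenvalue `Λ_i` of the Hermitian Wilson operator
along a one-link circle by `2 ∫ φ(E) N_i(E) dE`, `N_i(E) = #{s ∈ [0, 4π] : Λ_i(s) = E}`.  Summed over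
the `12 L⁴` sorted indices this is controlled, uniformly in `L`, by

  `Σ_i N_i(E) ≤ 97 · 24 = 2328` for every level `E` off a finite set

(`coareaWegner_oneLinkCircle_levelCount`): a level that is not FLAT (not an eigenvalue along the whole
circle) is met at `≤ 48` parameters per period (hypothesis `hzero` = the landed `stub_circleZeroCount`,
through bridge B `coareaWegner_oneLinkCircle_crossings`), hence at `≤ 48 + 48 + 1` parameters in
`[0, 4π]` by `2π`-periodicity, each time with multiplicity `≤ 24` among the sorted eigenvalues
(bridge D `coareaWegner_oneLink_eigenvalue_mult_le`); the flat levels are eigenvalues at `t = 0`,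
finitely many.
-/

noncomputable section

namespace Summit.QuantumFields.QCD.Cruxes.WegnerEstimate.ResolventCell

open MeasureTheory
open scoped Matrix BigOperators ENNReal
open Literature.MathematicalPhysics.QuantumLattice Literature.MathematicalPhysics.QuantumFieldTheory
  Literature.Probability.LatticeModels
open Matrix
open scoped ComplexOrder

/-- A sorted eigenvalue is an eigenvalue: if `eigenvalues₀ A i = E` then `det (A − E·1) = 0`. -/
theorem coareaWegner_det_sub_eq_zero_of_eigenvalues₀ {n : Type*} [Fintype n] [DecidableEq n]
    {A : Matrix n n ℂ} (hA : A.IsHermitian) (i : Fin (Fintype.card n)) {E : ℝ}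
    (hi : hA.eigenvalues₀ i = E) :
    (A - ((E : ℝ) : ℂ) • (1 : Matrix n n ℂ)).det = 0 := by
  set e : Fin (Fintype.card n) ≃ n := Fintype.equivOfCardEq (Fintype.card_fin _) with he
  have hj : hA.eigenvalues (e i) = E := by
    show hA.eigenvalues₀ (e.symm (e i)) = E
    rw [Equiv.symm_apply_apply, hi]
  rw [← Matrix.exists_mulVec_eq_zero_iff]
  refine ⟨⇑(hA.eigenvectorBasis (e i)), ?_, ?_⟩
  · intro h0
    have h1 := (hA.eigenvectorBasis).orthonormal.1 (e i)
    have h2 : hA.eigenvectorBasis (e i) = 0 := by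
      apply PiLp.ext
      intro p
      exact congrFun h0 p
    rw [h2, norm_zero] at h1
    exact zero_ne_one h1
  · rw [Matrix.sub_mulVec, Matrix.smul_mulVec, Matrix.one_mulVec, hA.mulVec_eigenvectorBasis, hj,
      RCLike.real_smul_eq_coe_smul (K := ℂ), sub_eq_zero]
    rfl

/-- The number of sorted indices at a level equals the number of Mathlib's `eigenvalues` at it. -/
theorem coareaWegner_card_eigenvalues₀_eq {n : Type*} [Fintype n] [DecidableEq n]
    {A : Matrix n n ℂ} (hA : A.IsHermitian) (E : ℝ) :
    Fintype.card {i : Fin (Fintype.card n) // hA.eigenvalues₀ i = E} =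
      Fintype.card {j : n // hA.eigenvalues j = E} := by
  set e : Fin (Fintype.card n) ≃ n := Fintype.equivOfCardEq (Fintype.card_fin _) with he
  refine Fintype.card_congr (e.subtypeEquiv fun i => ?_)
  show hA.eigenvalues₀ i = E ↔ hA.eigenvalues₀ (e.symm (e i)) = E
  rw [Equiv.symm_apply_apply]

/-- If `det (A − E·1) = 0` for a Hermitian `A` then `E` is one of Mathlib's eigenvalues of `A`. -/
theorem coareaWegner_exists_eigenvalues_eq_of_det {n : Type*} [Fintype n] [DecidableEq n]
    {A : Matrix n n ℂ} (hA : A.IsHermitian) {E : ℝ}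
    (hdet : (A - ((E : ℝ) : ℂ) • (1 : Matrix n n ℂ)).det = 0) : ∃ j, hA.eigenvalues j = E := by
  have h1 : (((E : ℝ) : ℂ) • (1 : Matrix n n ℂ) - A).det = 0 := by
    have : ((E : ℝ) : ℂ) • (1 : Matrix n n ℂ) - A = -(A - ((E : ℝ) : ℂ) • (1 : Matrix n n ℂ)) := by abel
    rw [this, det_neg, hdet, mul_zero]
  have h2 : (((E : ℝ) : ℂ) • (1 : Matrix n n ℂ) - A).det = A.charpoly.eval ((E : ℝ) : ℂ) := by
    rw [Matrix.eval_charpoly, Matrix.scalar_apply, Matrix.smul_one_eq_diagonal]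
  rw [h2, hA.charpoly_eq, Polynomial.eval_prod, Finset.prod_eq_zero_iff] at h1
  obtain ⟨j, -, hj⟩ := h1
  refine ⟨j, ?_⟩
  simp only [Polynomial.eval_sub, Polynomial.eval_X, Polynomial.eval_C, sub_eq_zero] at hj
  have h3 := congrArg Complex.re hj
  simpa using h3.symm

/-- Sorted eigenvalues depend only on the matrix (not on the Hermitian-ness witness). -/
theorem coareaWegner_eigenvalues₀_congr {n : Type*} [Fintype n] [DecidableEq n]
    {A B : Matrix n n ℂ} (hA : A.IsHermitian) (hB : B.IsHermitian) (h : A = B) :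
    hA.eigenvalues₀ = hB.eigenvalues₀ := by
  subst h
  rfl

/-- **Level-crossing count with multiplicity, abstract form.**  For a `2π`-periodic Hermitian family
`H(s)` such that every level `E` is either flat (`det (H(s) − E) = 0` for all `s`) or met at finitely
many, at most `48`, parameters per period, and such that non-flat levels have multiplicity `≤ 24` at
every parameter: off the finite set of flat levels, `Σ_i #{s ∈ [0, 4π] : Λ_i(s) = E} ≤ 2328`. -/
theorem coareaWegner_levelCount_of_crossings {n : Type*} [Fintype n] [DecidableEq n]
    (Hs : ℝ → Matrix n n ℂ) (hH : ∀ s, (Hs s).IsHermitian) (hper : ∀ s, Hs (s + 2 * Real.pi) = Hs s)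
    (hcross : ∀ E : ℝ,
      (∀ t : ℝ, (Hs t - ((E : ℝ) : ℂ) • (1 : Matrix n n ℂ)).det = 0) ∨
      ({t : ℝ | t ∈ Set.Ico (0 : ℝ) (2 * Real.pi) ∧ (Hs t - ((E : ℝ) : ℂ) • (1 : Matrix n n ℂ)).det = 0}.Finite ∧
        {t : ℝ | t ∈ Set.Ico (0 : ℝ) (2 * Real.pi) ∧
          (Hs t - ((E : ℝ) : ℂ) • (1 : Matrix n n ℂ)).det = 0}.ncard ≤ 48))
    (hmult : ∀ (E : ℝ) (s t' : ℝ), (Hs t' - ((E : ℝ) : ℂ) • (1 : Matrix n n ℂ)).det ≠ 0 →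
      Fintype.card {j : n // (hH s).eigenvalues j = E} ≤ 24) :
    ∃ F : Set ℝ, F.Finite ∧ ∀ E ∉ F,
      ∑ i : Fin (Fintype.card n),
        (({s : ℝ | s ∈ Set.Icc 0 (2 * Real.pi + 2 * Real.pi) ∧ (hH s).eigenvalues₀ i = E}.encard : ENat) :
          ENNReal) ≤ 2328 := by
  classical
  -- the flat levels: eigenvalues along the whole circle, in particular at `s = 0`
  set F : Set ℝ := {E | ∀ s : ℝ, (Hs s - ((E : ℝ) : ℂ) • (1 : Matrix n n ℂ)).det = 0} with hF
  have hFfin : F.Finite := by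
    refine (Set.finite_range (hH 0).eigenvalues).subset fun E hE => ?_
    obtain ⟨j, hj⟩ := coareaWegner_exists_eigenvalues_eq_of_det (hH 0) (hE 0)
    exact ⟨j, hj⟩
  refine ⟨F, hFfin, fun E hE => ?_⟩
  -- a non-flat level: a parameter `t'` with `det (H(t') − E) ≠ 0`
  obtain ⟨t', ht'⟩ : ∃ t', (Hs t' - ((E : ℝ) : ℂ) • (1 : Matrix n n ℂ)).det ≠ 0 := by
    by_contra h
    push Not at h
    exact hE h
  -- crossings per period
  set A : Set ℝ := {t : ℝ | t ∈ Set.Ico (0 : ℝ) (2 * Real.pi) ∧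
    (Hs t - ((E : ℝ) : ℂ) • (1 : Matrix n n ℂ)).det = 0} with hAdef
  obtain ⟨hAfin, hAcard⟩ : A.Finite ∧ A.ncard ≤ 48 := by
    rcases hcross E with h0 | h
    · exact absurd (h0 t') ht'
    · exact h
  -- the zero set over two periods
  set Z : Set ℝ := {s : ℝ | s ∈ Set.Icc 0 (2 * Real.pi + 2 * Real.pi) ∧
    (Hs s - ((E : ℝ) : ℂ) • (1 : Matrix n n ℂ)).det = 0} with hZ
  have hZsub : Z ⊆ A ∪ ((fun t => t + 2 * Real.pi) '' A) ∪ {2 * Real.pi + 2 * Real.pi} := by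
    intro s hs
    obtain ⟨⟨hs0, hs1⟩, hdet⟩ := hs
    rcases lt_or_ge s (2 * Real.pi) with hlt | hge
    · exact Or.inl (Or.inl ⟨⟨hs0, hlt⟩, hdet⟩)
    · rcases hs1.lt_or_eq with hlt2 | heq
      · refine Or.inl (Or.inr ⟨s - 2 * Real.pi, ⟨⟨by linarith, by linarith⟩, ?_⟩, by ring⟩)
        have : Hs (s - 2 * Real.pi) = Hs s := by
          have h := hper (s - 2 * Real.pi)
          rw [sub_add_cancel] at h
          exact h.symm
        rw [this]
        exact hdet
      · exact Or.inr heq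
  have hUfin : (A ∪ ((fun t => t + 2 * Real.pi) '' A) ∪ {2 * Real.pi + 2 * Real.pi}).Finite :=
    (hAfin.union (hAfin.image _)).union (Set.finite_singleton _)
  have hZfin : Z.Finite := hUfin.subset hZsub
  have hZcard : Z.ncard ≤ 97 := by
    calc Z.ncard ≤ (A ∪ ((fun t => t + 2 * Real.pi) '' A) ∪ {2 * Real.pi + 2 * Real.pi}).ncard :=
          Set.ncard_le_ncard hZsub hUfin
      _ ≤ (A ∪ ((fun t => t + 2 * Real.pi) '' A)).ncard + ({2 * Real.pi + 2 * Real.pi} : Set ℝ).ncard :=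
          Set.ncard_union_le _ _
      _ ≤ (A.ncard + ((fun t => t + 2 * Real.pi) '' A).ncard) + 1 := by
          rw [Set.ncard_singleton]
          exact Nat.add_le_add_right (Set.ncard_union_le _ _) _
      _ ≤ (48 + 48) + 1 :=
          Nat.add_le_add_right (add_le_add hAcard ((Set.ncard_image_le hAfin).trans hAcard)) _
      _ = 97 := by norm_num
  -- each sorted level set sits inside `Z`, with fibres of size `≤ 24`
  set Zf : Finset ℝ := hZfin.toFinset with hZf
  have hZfcard : Zf.card ≤ 97 := by
    rw [hZf, ← Set.ncard_eq_toFinset_card Z hZfin]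
    exact hZcard
  have hTi : ∀ i : Fin (Fintype.card n),
      {s : ℝ | s ∈ Set.Icc 0 (2 * Real.pi + 2 * Real.pi) ∧ (hH s).eigenvalues₀ i = E} =
        ↑(Zf.filter fun s => (hH s).eigenvalues₀ i = E) := by
    intro i
    ext s
    simp only [Finset.coe_filter, Set.Finite.mem_toFinset, Set.mem_setOf_eq, hZf]
    constructor
    · rintro ⟨hs, hi⟩
      exact ⟨⟨hs, coareaWegner_det_sub_eq_zero_of_eigenvalues₀ (hH s) i hi⟩, hi⟩
    · rintro ⟨⟨hs, -⟩, hi⟩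
      exact ⟨hs, hi⟩
  have hmult' : ∀ s : ℝ,
      (Finset.univ.filter fun i : Fin (Fintype.card n) => (hH s).eigenvalues₀ i = E).card ≤ 24 := by
    intro s
    rw [← Fintype.card_subtype, coareaWegner_card_eigenvalues₀_eq (hH s) E]
    exact hmult E s t' ht'
  calc ∑ i : Fin (Fintype.card n),
        (({s : ℝ | s ∈ Set.Icc 0 (2 * Real.pi + 2 * Real.pi) ∧ (hH s).eigenvalues₀ i = E}.encard : ENat) :
          ENNReal)
      = ∑ i : Fin (Fintype.card n), ((Zf.filter fun s => (hH s).eigenvalues₀ i = E).card : ENNReal) := by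
        refine Finset.sum_congr rfl fun i _ => ?_
        rw [hTi i, Set.encard_coe_eq_coe_finsetCard, ENat.toENNReal_coe]
    _ = ((∑ i : Fin (Fintype.card n), (Zf.filter fun s => (hH s).eigenvalues₀ i = E).card : ℕ) : ENNReal) := by
        push_cast
        rfl
    _ ≤ ((97 * 24 : ℕ) : ENNReal) := by
        gcongr
        calc ∑ i : Fin (Fintype.card n), (Zf.filter fun s => (hH s).eigenvalues₀ i = E).card
            = ∑ i : Fin (Fintype.card n), ∑ s ∈ Zf, (if (hH s).eigenvalues₀ i = E then 1 else 0) := by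
              refine Finset.sum_congr rfl fun i _ => ?_
              rw [Finset.card_filter]
          _ = ∑ s ∈ Zf, ∑ i : Fin (Fintype.card n), (if (hH s).eigenvalues₀ i = E then 1 else 0) :=
              Finset.sum_comm
          _ = ∑ s ∈ Zf, (Finset.univ.filter fun i : Fin (Fintype.card n) => (hH s).eigenvalues₀ i = E).card := by
              refine Finset.sum_congr rfl fun s _ => ?_
              rw [Finset.card_filter]
          _ ≤ ∑ s ∈ Zf, 24 := Finset.sum_le_sum fun s _ => hmult' s
          _ = Zf.card * 24 := by rw [Finset.sum_const, smul_eq_mul]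
          _ ≤ 97 * 24 := Nat.mul_le_mul_right _ hZfcard
    _ = 2328 := by norm_num

/-- **Level-crossing count with multiplicity along a one-link circle** (uniform in the volume).
For a gauge field `W`, a link `e = (z, μ)`, a `2π`-periodic link curve `c(t) = δ₀ + cos t δ₁ + sin t δ₂`
in `SU(3)` and the sorted eigenvalues `Λ_i(s)` of the Hermitian `H(s) = Γ₅ D_W(W[e ↦ W(e) c(s)], m₀, 1)`:
off a finite set of levels `E`, `Σ_i #{s ∈ [0, 4π] : Λ_i(s) = E} ≤ 2328 = (48 + 48 + 1) · 24`
(hypothesis `hzero` = the landed `stub_circleZeroCount`; bridges B and D). -/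
theorem coareaWegner_oneLinkCircle_levelCount
    (hzero : ∀ (N r : ℕ) (A : Matrix (Fin N) (Fin N) ℂ) (B : Matrix (Fin N) (Fin r) ℂ) (C : Matrix (Fin r) (Fin N) ℂ)
      (δ₀ δ₁ δ₂ : Matrix (Fin r) (Fin r) ℂ),
      (∀ t : ℝ, (A + B * (δ₀ + ((Real.cos t : ℝ) : ℂ) • δ₁ + ((Real.sin t : ℝ) : ℂ) • δ₂) * C).det = 0) ∨
      ({t : ℝ | t ∈ Set.Ico (0 : ℝ) (2 * Real.pi) ∧
          (A + B * (δ₀ + ((Real.cos t : ℝ) : ℂ) • δ₁ + ((Real.sin t : ℝ) : ℂ) • δ₂) * C).det = 0}.Finite ∧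
        {t : ℝ | t ∈ Set.Ico (0 : ℝ) (2 * Real.pi) ∧
          (A + B * (δ₀ + ((Real.cos t : ℝ) : ℂ) • δ₁ + ((Real.sin t : ℝ) : ℂ) • δ₂) * C).det = 0}.ncard ≤ 2 * r))
    {L : ℕ} [NeZero L] (W : GaugeConfig 4 L SU3) (m₀ : ℝ) (z : TorusSite 4 L) (μ : Fin 4) (c : ℝ → SU3)
    (δ₀ δ₁ δ₂ : Matrix (Fin 3) (Fin 3) ℂ)
    (hc : ∀ t, ((c t : SU3) : Matrix (Fin 3) (Fin 3) ℂ) =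
      δ₀ + ((Real.cos t : ℝ) : ℂ) • δ₁ + ((Real.sin t : ℝ) : ℂ) • δ₂)
    (hper : ∀ t, c (t + 2 * Real.pi) = c t)
    (hH : ∀ s : ℝ, (spinorLift gammaFive * wilsonDirac (fundamentalRep (Fin 3))
      (Function.update W (z, μ) (W (z, μ) * c s)) m₀ 1).IsHermitian) :
    ∃ F : Set ℝ, F.Finite ∧ ∀ E ∉ F,
      ∑ i : Fin (Fintype.card (QuarkIdx L)),
        (({s : ℝ | s ∈ Set.Icc 0 (2 * Real.pi + 2 * Real.pi) ∧ (hH s).eigenvalues₀ i = E}.encard : ENat) :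
          ENNReal) ≤ 2328 :=
  coareaWegner_levelCount_of_crossings
    (fun s => spinorLift gammaFive * wilsonDirac (fundamentalRep (Fin 3))
      (Function.update W (z, μ) (W (z, μ) * c s)) m₀ 1)
    hH (fun s => by simp only [hper])
    (fun E => coareaWegner_oneLinkCircle_crossings hzero W m₀ z μ c δ₀ δ₁ δ₂ hc _)
    (fun E s t' ht' => coareaWegner_oneLink_eigenvalue_mult_le W m₀ z μ _ _ E ht' (hH s))

end Summit.QuantumFields.QCD.Cruxes.WegnerEstimate.ResolventCell

end
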